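import Mathlib
import Summits.NavierStokesRegularity.NavierStokesRegularity.Theses.UnthreadedDoor
import Summits.NavierStokesRegularity.NavierStokesRegularity.Theorems.UnthreadedDoorUnthreadedZoom
import Summits.NavierStokesRegularity.NavierStokesRegularity.Theorems.UnthreadedDoorShiftedPoloidalClass
import Summits.NavierStokesRegularity.NavierStokesRegularity.Theorems.UnthreadedDoorConstantSliceExtinction
import HarnessLib

/-!
# `UnthreadedDoor.Assembly` (item stmt-NavierStokesRegularity-27412) and the door conditional on its
  one remaining open item, the shared Liouville kernel `PoloidalLiouville` (stmt-1222)

* `unthreadedDoor_assembly_proof : Assembly` — pure logic: `Assembly` is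
  `UnthreadedZoom → ShiftedPoloidalClass → PoloidalLiouville → ConstantSliceExtinction → Target`, i.e. the
  type of the route's planner-authored deciding theorem `Theses.UnthreadedDoor.closes` (kernel-checked in
  the route file); this item is that composition BY NAME.
* `unthreadedDoor_target_of_poloidalLiouville : PoloidalLiouville → Target` — the door with its three
  PROVED items plugged in by name (`unthreadedDoor_unthreadedZoom_proof` p629898, item 27411;
  `unthreadedDoor_shiftedPoloidalClass_proof` p630992, item 27410;
  `unthreadedDoor_constantSliceExtinction_proof` p630564, item 27409): after this file the route's
  `Target` (rung N0-LocalTubeDoorUnthreaded) depends on EXACTLY ONE open statement, the symmetry-free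
  no-swirl Liouville theorem `PoloidalLiouville` (= `ThreadingFlux.PoloidalLiouville`, item 1222, the
  declared XL wall; only its axisymmetric case `knss_axisymmetric_no_swirl'_holds` is a tree theorem).

HONEST FRAMING: bookkeeping; the door's `Target` is NOT proved (it is proved CONDITIONALLY on the open
item 1222), and nothing here bears on Navier–Stokes regularity; no summit statement is proved here.
-/

noncomputable section

set_option linter.dupNamespace false

namespace Summit.NavierStokesRegularity.NavierStokesRegularity.Theorems

open Summit.NavierStokesRegularity.NavierStokesRegularity.Theses.UnthreadedDoor

/-- **Item stmt-NavierStokesRegularity-27412** (`UnthreadedDoor.Assembly`): the four items compose to the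
door's `Target` — by the route's own kernel-checked deciding theorem `closes`. [folklore] -/
theorem unthreadedDoor_assembly_proof :
    Summit.NavierStokesRegularity.NavierStokesRegularity.Theses.UnthreadedDoor.Assembly := by
  unfold Summit.NavierStokesRegularity.NavierStokesRegularity.Theses.UnthreadedDoor.Assembly
  exact fun hZ hS hP hE => closes hZ hS hP hE

/-- **The unthreaded door modulo its Liouville kernel**: with items 27411, 27410, 27409 proved in the
tree, `PoloidalLiouville` (stmt-1222, OPEN) alone implies the door's `Target`. [folklore] -/
theorem unthreadedDoor_target_of_poloidalLiouville
    (hP : Summit.NavierStokesRegularity.NavierStokesRegularity.Theses.UnthreadedDoor.PoloidalLiouville) :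
    Summit.NavierStokesRegularity.NavierStokesRegularity.Theses.UnthreadedDoor.Target :=
  closes unthreadedDoor_unthreadedZoom_proof unthreadedDoor_shiftedPoloidalClass_proof hP
    unthreadedDoor_constantSliceExtinction_proof

end Summit.NavierStokesRegularity.NavierStokesRegularity.Theorems

end
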